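import Literature.NumberTheory.IwasawaTheory.Fukuda1994Thm1RankPackageCentral
import Literature.NumberTheory.IwasawaTheory.FukudaGroupCentralLayer
import Literature.NumberTheory.IwasawaTheory.ClassicalMuVanishesIffBoundedRank
import HarnessLib

/-!
# A ONE-LAYER CENTRAL criterion for bounded `p`-ranks and `μ = 0`: if `Gal(K_{n+j}/K)` acts trivially on `Cl(K_{n+j})/p` at a single
# layer `n + j` (`n ≥` Fukuda's index, `p^j ≥ 3`), then `rank_p Cl(K_{n+k}) ≤ rank_p Cl(K_{n+j})` for EVERY `k` (proved, finite level)

`Proofs`-style file (theorems only: no definition, no named fact, no `sorry`) in topic `NumberTheory/IwasawaTheory`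
(namespace = path), written by the literature seat `bsd-potss-conjA-anchor` g21 (cell `bsd-potss`; serves the asides
stmt-BirchSwinnertonDyer-19386 / 19413 and the `μ`-roads of the record lanes k9-c4 / k8t-c4; closes nothing; no class group is computed here).
DOOR L11 of the cell (memo conjA-anchor g20 door-L10 §3; bricks: `FukudaSmallRankAlgebra` §4, `FukudaGroupCentralLayer`,
`HilbertClassFieldCentralModP` (g20), `UnramifiedElementaryCentralModP`, `Fukuda1994Thm1RankLayerCentral`, `Fukuda1994Thm1RankPackageCentral` (g21)).

THE THEOREM (`classGroupPRank_le_of_classGroup_mulEquiv_trivial`).  `K` a number field, `p` a prime, `κ` a `ℤ_p`-extension of `K` totally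
ramified at every ramified prime from layer `n₀` (`TotallyRamifiedFrom κ n₀`), `n ≥ n₀`, `j` with `1 < p^j - 1` (`p` odd and `j ≥ 1`, or `p = 2`
and `j ≥ 2`).  IF every `K`-automorphism `σ` of the layer `K_{n+j}` acts trivially on `Cl(K_{n+j})/Cl(K_{n+j})^p`
(`σc·c⁻¹ ∈ Cl^p`; e.g. when `Gal(K_{n+j}/K)` acts trivially on the whole `p`-part `Cl(K_{n+j})[p^∞]`), THEN `rank_p Cl(K_{n+k}) ≤ rank_p Cl(K_{n+j})` for EVERY `k ≥ 0`.  Consequently the `p`-ranks along the tower are bounded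
(`exists_forall_classGroupPRank_le_of_classGroup_mulEquiv_trivial`) and Iwasawa's `μ`-invariant vanishes
(`classicalMuVanishes_of_classGroup_mulEquiv_trivial`, via the cell's «bounded ranks ⟹ `μ = 0`»).  Smallest case (`p` odd, `n = n₀`, `j = 1`):
**«`Gal(K_{n₀+1}/K)` acts trivially on `Cl(K_{n₀+1})/p` ⟹ rank_p Cl(K_m) ≤ rank_p Cl(K_{n₀+1})` for all `m ≥ n₀` and `μ = 0`»**
(`classicalMuVanishes_of_classGroup_mulEquiv_trivial_succ`) — growth `rank_p Cl(K_{n₀}) < rank_p Cl(K_{n₀+1})` is allowed, and the rank at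
layer `n₀ + 1` may exceed the small-rank bound `p - 2` of door L10 (`ClassGroupPRankSmallRankCriterion`).

WHY (Washington §13.3 in one line: `X/(ν_{n,j}Y + pX) ≅ A_{n+j}/p` as `Γ`-modules; if `γ` acts trivially then `(γ-1)X ⊆ ν Y + pX`, and on
`X/pX` — where `ν = T^{p^j-1}`, `T = γ - 1` nilpotent — `TX̄ ⊆ T^{p^j-1}X̄` forces `TX̄ = 0` when `p^j - 1 > 1`, so `ν_{n,k}Y ⊆ pX` for all `k`
and the ranks are bounded by `dim X̄ = rank_p A_{n+j}`).  At finite level: the package with central layers (`exists_layer_package_central`: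
`G = Gal(H_p(K_{n+t})/K_n)`, `A`, `g`, `𝓘`, `[G_k : N_kP_k] = p^{rank_p Cl(K_{n+k})}`, and «class-group hypothesis ⟹ `⁅G, G_j⁆ ≤ N_jP_j`»)
feeds `FukudaGroup.relIndex_layer_le_of_commutator_le` (nilpotency index `m = 1`, `FukudaSmallRank.card_quotient_le_of_map_sub_one_pow_le`).

Not found in print in this form; the ingredients are Washington's Lemmas 13.15/13.18, Prop. 13.22, the functoriality of the Artin symbol
(Neukirch IV §6, VI (7.1)) and Fukuda's finite-level method, cited at each use (D-0014: our proof of a statement assembled from cited ingredients).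

References: [Washington1997] L. Washington, *Introduction to Cyclotomic Fields*, 2nd ed., §13.3 Lemmas 13.15, 13.18, Prop. 13.22, 13.23;
[Fukuda1994] T. Fukuda, *Remarks on ℤ_p-extensions of number fields*, Proc. Japan Acad. 70 A (1994), Thm. 1, p. 264; [NeukirchANT1999]
J. Neukirch, *Algebraic Number Theory*, Ch. IV §6, Ch. VI §7 Thm. (7.1); [Lang1990] Ch. 13 §1 Lemma 3.
-/

set_option autoImplicit false

noncomputable section

open scoped NumberField IsMulCommutative
open NumberField Field Finset

namespace Literature.NumberTheory.IwasawaTheory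

open Literature.NumberTheory.EllipticCurves Literature.NumberTheory.NumberFields

variable {K : Type} [Field K] [NumberField K] {p : ℕ} [hp : Fact p.Prime]

/-! ## §1 Inside the package: `r_{n+k} ≤ r_{n+j}` whenever layer `n + j` is centralised -/

/-- The finite-level step: in the package of `K_n ⊆ K_{n+t} ⊆ H_p(K_{n+t})` (`t ≥ max(j, k, 1)`), if `Gal(K_{n+j}/K)` acts trivially on
`Cl(K_{n+j})/p` and `1 < p^j - 1`, then `rank_p Cl(K_{n+k}) ≤ rank_p Cl(K_{n+j})`.
[cite: Washington1997, §13.3 Lemma 13.18 and Prop. 13.22] [cite: Fukuda1994, Thm. 1 (proof, p. 264)] -/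
private theorem layer_central (κ : ZpExtension K p) {n₀ n : ℕ} (hκ : TotallyRamifiedFrom κ n₀) (hn : n₀ ≤ n) {j k t : ℕ}
    (ht : 1 ≤ t) (hj : j ≤ t) (hk : k ≤ t) (hpj : 1 < p ^ j - 1)
    (hσ : ∀ (σ : (κ.layer (n + j)) ≃ₐ[K] (κ.layer (n + j))) (c : ClassGroup (𝓞 (κ.layer (n + j)))),
      ClassGroup.mulEquiv (AmbiguousClass.intAut σ) c * c⁻¹ ∈
        (powMonoidHom p : ClassGroup (𝓞 (κ.layer (n + j))) →* ClassGroup (𝓞 (κ.layer (n + j)))).range) :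
    classGroupPRank κ (n + k) ≤ classGroupPRank κ (n + j) := by
  classical
  have hp1 : 1 < p := hp.out.one_lt
  obtain ⟨G, _instG, _instF, A', hA'n, _instC, g, 𝓘, hgA, hgen, hA'index, h𝓘, hg𝓘, -, hlayer⟩ :=
    exists_layer_package_central κ hκ hn t ht
  obtain ⟨Gj, hAGj, hGj, -, hrj, hcentj⟩ := hlayer j hj
  obtain ⟨Gk, hAGk, hGk, -, hrk, -⟩ := hlayer k hk
  have hcent : ⁅(⊤ : Subgroup G), A'⁆ ≤
      (⁅Gj, Gj⁆ ⊔ ⨆ I ∈ 𝓘, I ⊓ Gj) ⊔ Subgroup.closure ((fun x : G => x ^ p) '' (Gj : Set G)) :=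
    (Subgroup.commutator_mono le_rfl hAGj).trans (hcentj hσ)
  have hle := FukudaGroup.relIndex_layer_le_of_commutator_le hgA hgen hA'index h𝓘 hg𝓘 hj hpj hAGj hGj hcent hk hAGk hGk
  rw [hrj, hrk] at hle
  exact (Nat.pow_le_pow_iff_right hp1).mp hle

/-! ## §2 The criterion along the tower -/

/-- **ONE-LAYER CENTRAL CRITERION.**  `κ` a `ℤ_p`-extension of the number field `K`, totally ramified at the ramified primes from layer
`n₀` (`TotallyRamifiedFrom κ n₀`), `n₀ ≤ n`, `1 < p^j - 1`: if every `K`-automorphism of `K_{n+j}` acts trivially on `Cl(K_{n+j})/p`, then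
`rank_p Cl(K_{n+k}) ≤ rank_p Cl(K_{n+j})` for every `k`.
[cite: Washington1997, §13.3 Lemma 13.18 and Prop. 13.22] [cite: Fukuda1994, Thm. 1 (proof, p. 264)]
[cite: NeukirchANT1999, Ch. IV §6 and Ch. VI §7 Thm. (7.1)] -/
theorem classGroupPRank_le_of_classGroup_mulEquiv_trivial (κ : ZpExtension K p) {n₀ n : ℕ} (hκ : TotallyRamifiedFrom κ n₀)
    (hn : n₀ ≤ n) {j : ℕ} (hpj : 1 < p ^ j - 1)
    (hσ : ∀ (σ : (κ.layer (n + j)) ≃ₐ[K] (κ.layer (n + j))) (c : ClassGroup (𝓞 (κ.layer (n + j)))),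
      ClassGroup.mulEquiv (AmbiguousClass.intAut σ) c * c⁻¹ ∈
        (powMonoidHom p : ClassGroup (𝓞 (κ.layer (n + j))) →* ClassGroup (𝓞 (κ.layer (n + j)))).range)
    (k : ℕ) : classGroupPRank κ (n + k) ≤ classGroupPRank κ (n + j) :=
  layer_central κ hκ hn (t := max (max j k) 1) (le_max_right _ _) ((le_max_left _ _).trans (le_max_left _ _))
    ((le_max_right _ _).trans (le_max_left _ _)) hpj hσ

/-- **Bounded `p`-ranks from one centralised layer**: under `TotallyRamifiedFrom κ n₀`, `n₀ ≤ n`, `1 < p^j - 1` and the class-group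
hypothesis at layer `n + j`, the `p`-ranks `rank_p Cl(K_m)` are bounded (by the maximum of the finitely many ranks below layer `n` and
`rank_p Cl(K_{n+j})`). [cite: Washington1997, §13.3 Prop. 13.22–13.23] [cite: Fukuda1994, Thm. 1 (proof, p. 264)] -/
theorem exists_forall_classGroupPRank_le_of_classGroup_mulEquiv_trivial (κ : ZpExtension K p) {n₀ n : ℕ}
    (hκ : TotallyRamifiedFrom κ n₀) (hn : n₀ ≤ n) {j : ℕ} (hpj : 1 < p ^ j - 1)
    (hσ : ∀ (σ : (κ.layer (n + j)) ≃ₐ[K] (κ.layer (n + j))) (c : ClassGroup (𝓞 (κ.layer (n + j)))),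
      ClassGroup.mulEquiv (AmbiguousClass.intAut σ) c * c⁻¹ ∈
        (powMonoidHom p : ClassGroup (𝓞 (κ.layer (n + j))) →* ClassGroup (𝓞 (κ.layer (n + j)))).range) :
    ∃ B : ℕ, ∀ m, classGroupPRank κ m ≤ B := by
  refine ⟨(range n).sup (classGroupPRank κ) ⊔ classGroupPRank κ (n + j), fun m => ?_⟩
  rcases lt_or_ge m n with hm | hm
  · exact le_sup_of_le_left (Finset.le_sup (f := classGroupPRank κ) (mem_range.mpr hm))
  · obtain ⟨k, rfl⟩ : ∃ k, m = n + k := ⟨m - n, by omega⟩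
    exact le_sup_of_le_right (classGroupPRank_le_of_classGroup_mulEquiv_trivial κ hκ hn hpj hσ k)

/-- **`μ = 0` from one centralised layer**: under `TotallyRamifiedFrom κ n₀`, `n₀ ≤ n`, `1 < p^j - 1` and the class-group hypothesis at
layer `n + j`, Iwasawa's `μ`-invariant of `κ` vanishes (growth form `ClassicalMuVanishes`; via the cell's finite-level «bounded ranks ⟹
`μ = 0`», `classicalMuVanishes_of_forall_classGroupPRank_le`).
[cite: Washington1997, §13.3 Prop. 13.22–13.23] [cite: Fukuda1994, Thm. 1 (2), p. 264] -/
theorem classicalMuVanishes_of_classGroup_mulEquiv_trivial (κ : ZpExtension K p) {n₀ n : ℕ} (hκ : TotallyRamifiedFrom κ n₀)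
    (hn : n₀ ≤ n) {j : ℕ} (hpj : 1 < p ^ j - 1)
    (hσ : ∀ (σ : (κ.layer (n + j)) ≃ₐ[K] (κ.layer (n + j))) (c : ClassGroup (𝓞 (κ.layer (n + j)))),
      ClassGroup.mulEquiv (AmbiguousClass.intAut σ) c * c⁻¹ ∈
        (powMonoidHom p : ClassGroup (𝓞 (κ.layer (n + j))) →* ClassGroup (𝓞 (κ.layer (n + j)))).range) :
    ClassicalMuVanishes κ := by
  obtain ⟨B, hB⟩ := exists_forall_classGroupPRank_le_of_classGroup_mulEquiv_trivial κ hκ hn hpj hσ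
  exact classicalMuVanishes_of_forall_classGroupPRank_le κ hB

/-- **Smallest case (`p` odd, `j = 1`, base layer `n₀`)**: `TotallyRamifiedFrom κ n₀`, `p ≠ 2`, and every `K`-automorphism of `K_{n₀+1}`
trivial on `Cl(K_{n₀+1})/p` give bounded `p`-ranks (packaged as `∃ B`) and `μ = 0`.  For the census rows of the cell (`K = ℚ(P)`, `p = 3`,
`n₀ = 0`): «`Gal(K₁/K)` acts trivially on `Cl(K₁)/3` ⟹ `μ₃(K_cyc) = 0`».
[cite: Washington1997, §13.3 Prop. 13.22–13.23] [cite: Fukuda1994, Thm. 1 (2), p. 264] -/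
theorem classicalMuVanishes_of_classGroup_mulEquiv_trivial_succ (κ : ZpExtension K p) {n₀ : ℕ} (hκ : TotallyRamifiedFrom κ n₀)
    (hp2 : p ≠ 2)
    (hσ : ∀ (σ : (κ.layer (n₀ + 1)) ≃ₐ[K] (κ.layer (n₀ + 1))) (c : ClassGroup (𝓞 (κ.layer (n₀ + 1)))),
      ClassGroup.mulEquiv (AmbiguousClass.intAut σ) c * c⁻¹ ∈
        (powMonoidHom p : ClassGroup (𝓞 (κ.layer (n₀ + 1))) →* ClassGroup (𝓞 (κ.layer (n₀ + 1)))).range) :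
    (∃ B : ℕ, ∀ m, classGroupPRank κ m ≤ B) ∧ ClassicalMuVanishes κ := by
  have hp3 : 3 ≤ p := by
    rcases hp.out.eq_two_or_odd' with h | h
    · exact absurd h hp2
    · have := hp.out.two_le; rcases h with ⟨m, rfl⟩; omega
  have hpj : 1 < p ^ 1 - 1 := by rw [pow_one]; omega
  exact ⟨exists_forall_classGroupPRank_le_of_classGroup_mulEquiv_trivial κ hκ le_rfl hpj hσ,
    classicalMuVanishes_of_classGroup_mulEquiv_trivial κ hκ le_rfl hpj hσ⟩

end Literature.NumberTheory.IwasawaTheory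

end
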